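import Mathlib
import Summits.Ventures.PercRepro2.ThreeTermPinnedState
import Summits.Ventures.PercRepro2.ThreeTermPinnedDecide0
import Summits.Ventures.PercRepro2.ThreeTermPinnedDecide1
import Summits.Ventures.PercRepro2.ThreeTermPinnedDecide2_0
import Summits.Ventures.PercRepro2.ThreeTermPinnedDecide2_1
import Summits.Ventures.PercRepro2.ThreeTermPinnedDecide2_2
import Summits.Ventures.PercRepro2.ThreeTermPinnedDecide2_3

/-!
# Three-terminal parts, VI e: ROW 2′TRI WHENEVER THE TYPED EDGES ARE THE EDGES OF ONE UNMARKED
THREE-TERMINAL PART — on any pinned background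
(blind cell PercRepro2, night-3 g31, 2026-08-30; `proofs/NIGHT3-CERT.md` §40.7)

The assembly of the pinned-core theorem (2′TRI-PINPART, §40.5):

* `typedCount_part_eq` at `F = ∅`: the typed base is `Σ partLaw · partTable`, the table being `K₃` at the
  three pattern configurations `setOn S (cfg i) z` (`typedCount3_empty`), hence `KB` of their STATES
  (`K3_eq_KB`), which are the abstract states of the background's labeling (`st_eq_stAbs`) — or all off
  `Q` when `a₁ ~ a₂` in the background (then every entry is `0`);
* the labeling is bounded and guarded, so the kernel checks `pinsym_0`, `pinsym_1`, `pinsym_2_0 … pinsym_2_3` give the nonnegativity of the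
  symmetrised kernel on every triple of representative patterns (`symKBS_nonneg_rep`), patterns being
  read through `rep8` (`partTable_rep`);
* the part's law is copy-symmetric, so only the symmetrised table is seen (`sum_sym6`): the typed base
  is `(1/6) Σ partLaw · symKBS ≥ 0`.

**`typedCount_nonneg_pinned_part`**: for every finite graph, every marking, every unmarked three-terminal
part `W` with edge set `S`, every pinning `z` and every type map `τ`: `0 ≤ typedCount S z τ K₃` — row
2′TRI on an infinite family UNIFORM IN THE BACKGROUND (the typed edges are exactly the part's; any number
of them, e.g. a `K_{3,n}` bundle at three vertices of an arbitrary pinned graph).  Own work; standard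
axioms.
-/

namespace Summit.Ventures.PercRepro2

open Block ThreeTerm TypedStar CovForm CovForm.OneTyped

namespace Part

/-! ## The decide, combined -/

section Combine

/-- The four slices with first label `2` combined over the second label. -/
theorem pinsym_2 (f1 : Fin 4) (f2 : Fin 5) (f3 : Fin 6) (f4 : Fin 7) (f5 : Fin 8)
    (hg : Guard (lab' 2 f1 f2 f3 f4 f5) = true) : check5 (states5 (lab' 2 f1 f2 f3 f4 f5)) = true := by
  fin_cases f1
  · exact pinsym_2_0 f2 f3 f4 f5 hg
  · exact pinsym_2_1 f2 f3 f4 f5 hg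
  · exact pinsym_2_2 f2 f3 f4 f5 hg
  · exact pinsym_2_3 f2 f3 f4 f5 hg

/-- The three kernel checks combined over the first label. -/
theorem pinsym_lab (f0 : Fin 3) (f1 : Fin 4) (f2 : Fin 5) (f3 : Fin 6) (f4 : Fin 7) (f5 : Fin 8)
    (hg : Guard (lab' f0 f1 f2 f3 f4 f5) = true) : check5 (states5 (lab' f0 f1 f2 f3 f4 f5)) = true := by
  fin_cases f0
  · exact pinsym_0 f1 f2 f3 f4 f5 hg
  · exact pinsym_1 f1 f2 f3 f4 f5 hg
  · exact pinsym_2 f1 f2 f3 f4 f5 hg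

/-- A bounded labeling is a `lab'`. -/
lemma eq_lab' (f : Fin 6 → Fin 8) (hb : ∀ v, (f v).val ≤ v.val + 2) :
    f = lab' ⟨(f 0).val, by have := hb 0; simp at this; omega⟩ ⟨(f 1).val, by have := hb 1; simp at this; omega⟩
      ⟨(f 2).val, by have := hb 2; simp at this; omega⟩ ⟨(f 3).val, by have := hb 3; simp at this; omega⟩
      ⟨(f 4).val, by have := hb 4; simp at this; omega⟩ (f 5) := by
  funext v
  fin_cases v <;> rfl

/-- **The kernel check holds for every bounded guarded labeling.** -/
theorem check5_of_bounded (f : Fin 6 → Fin 8) (hb : ∀ v, (f v).val ≤ v.val + 2) (hg : Guard f = true) :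
    check5 (states5 f) = true := by
  rw [eq_lab' f hb] at hg ⊢
  exact pinsym_lab _ _ _ _ _ _ hg

/-- The symmetrised kernel is symmetric in its first two arguments. -/
lemma symKBS_swap12 (s₁ s₂ s₃ : St) : symKBS s₁ s₂ s₃ = symKBS s₂ s₁ s₃ := by
  unfold symKBS; ring

/-- The symmetrised kernel is symmetric in its last two arguments. -/
lemma symKBS_swap23 (s₁ s₂ s₃ : St) : symKBS s₁ s₂ s₃ = symKBS s₁ s₃ s₂ := by
  unfold symKBS; ring

/-- `pick (states5 f) r` is the abstract state at the representative pattern. -/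
lemma pick_states5 (f : Fin 6 → Fin 8) (r : Fin 5) : pick (states5 f) r = stAbs f (rep5 r) := by
  fin_cases r <;> rfl

/-- Every `rep8` value is a `rep5` value. -/
lemma exists_rep5 : ∀ i : Fin 8, ∃ r : Fin 5, rep5 r = rep8 i := by decide

/-- **The symmetrised kernel is nonnegative on every triple of representative patterns** of a bounded
guarded labeling (the sorted triples from the check, the others by symmetry). -/
theorem symKBS_nonneg_rep (f : Fin 6 → Fin 8) (hb : ∀ v, (f v).val ≤ v.val + 2) (hg : Guard f = true)
    (i j k : Fin 8) : 0 ≤ symKBS (stAbs f (rep8 i)) (stAbs f (rep8 j)) (stAbs f (rep8 k)) := by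
  have hc := check5_of_bounded f hb hg
  unfold check5 at hc
  rw [decide_eq_true_eq] at hc
  simp only [pick_states5] at hc
  obtain ⟨r, hr⟩ := exists_rep5 i
  obtain ⟨s, hs⟩ := exists_rep5 j
  obtain ⟨t, ht⟩ := exists_rep5 k
  rw [← hr, ← hs, ← ht]
  -- sort (r, s, t)
  rcases le_total r s with hrs | hsr <;> rcases le_total s t with hst | hts <;>
    rcases le_total r t with hrt | htr
  · exact hc r s t hrs hst
  · exact hc r s t hrs hst
  · rw [symKBS_swap23]; exact hc r t s hrt hts
  · rw [symKBS_swap23, symKBS_swap12]; exact hc t r s htr hrs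
  · rw [symKBS_swap12]; exact hc s r t hsr hrt
  · rw [symKBS_swap12, symKBS_swap23]; exact hc s t r hst htr
  · rw [symKBS_swap12, symKBS_swap23, symKBS_swap12]; exact hc t s r hts hsr
  · rw [symKBS_swap12, symKBS_swap23, symKBS_swap12]; exact hc t s r hts hsr

end Combine

/-! ## The symmetrisation of a contraction with a copy-symmetric law -/

section Sym

/-- Reindexing a triple sum over `Fin 8` along an equivalence of the index triples. -/
lemma sum3_reindex (g : Fin 8 → Fin 8 → Fin 8 → ℚ) (σ : Fin 8 × Fin 8 × Fin 8 ≃ Fin 8 × Fin 8 × Fin 8) :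
    (∑ i : Fin 8, ∑ j : Fin 8, ∑ k : Fin 8, g (σ (i, j, k)).1 (σ (i, j, k)).2.1 (σ (i, j, k)).2.2) =
      ∑ i : Fin 8, ∑ j : Fin 8, ∑ k : Fin 8, g i j k := by
  have e1 : (∑ i : Fin 8, ∑ j : Fin 8, ∑ k : Fin 8, g (σ (i, j, k)).1 (σ (i, j, k)).2.1 (σ (i, j, k)).2.2) =
      ∑ p : Fin 8 × Fin 8 × Fin 8, g (σ p).1 (σ p).2.1 (σ p).2.2 := by
    simp only [Fintype.sum_prod_type]
  have e2 : (∑ i : Fin 8, ∑ j : Fin 8, ∑ k : Fin 8, g i j k) =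
      ∑ p : Fin 8 × Fin 8 × Fin 8, g p.1 p.2.1 p.2.2 := by
    simp only [Fintype.sum_prod_type]
  rw [e1, e2]
  exact Equiv.sum_comp σ (fun p => g p.1 p.2.1 p.2.2)

/-- The transposition of the last two indices. -/
def σ23 : Fin 8 × Fin 8 × Fin 8 ≃ Fin 8 × Fin 8 × Fin 8 where
  toFun p := (p.1, p.2.2, p.2.1)
  invFun p := (p.1, p.2.2, p.2.1)
  left_inv := fun ⟨_, _, _⟩ => rfl
  right_inv := fun ⟨_, _, _⟩ => rfl

/-- The transposition of the first two indices. -/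
def σ12 : Fin 8 × Fin 8 × Fin 8 ≃ Fin 8 × Fin 8 × Fin 8 where
  toFun p := (p.2.1, p.1, p.2.2)
  invFun p := (p.2.1, p.1, p.2.2)
  left_inv := fun ⟨_, _, _⟩ => rfl
  right_inv := fun ⟨_, _, _⟩ => rfl

/-- The transposition of the outer indices. -/
def σ13 : Fin 8 × Fin 8 × Fin 8 ≃ Fin 8 × Fin 8 × Fin 8 where
  toFun p := (p.2.2, p.2.1, p.1)
  invFun p := (p.2.2, p.2.1, p.1)
  left_inv := fun ⟨_, _, _⟩ => rfl
  right_inv := fun ⟨_, _, _⟩ => rfl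

/-- The cycle `(i, j, k) ↦ (j, k, i)`. -/
def σc : Fin 8 × Fin 8 × Fin 8 ≃ Fin 8 × Fin 8 × Fin 8 where
  toFun p := (p.2.1, p.2.2, p.1)
  invFun p := (p.2.2, p.1, p.2.1)
  left_inv := fun ⟨_, _, _⟩ => rfl
  right_inv := fun ⟨_, _, _⟩ => rfl

/-- The cycle `(i, j, k) ↦ (k, i, j)`. -/
def σc' : Fin 8 × Fin 8 × Fin 8 ≃ Fin 8 × Fin 8 × Fin 8 where
  toFun p := (p.2.2, p.1, p.2.1)
  invFun p := (p.2.1, p.2.2, p.1)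
  left_inv := fun ⟨_, _, _⟩ => rfl
  right_inv := fun ⟨_, _, _⟩ => rfl

/-- **Symmetrising a contraction with a copy-symmetric law**: `6 Σ n · T = Σ n · (Σ_σ T ∘ σ)`. -/
lemma sum_sym6 {n : Fin 8 → Fin 8 → Fin 8 → ℚ} (hn : Sym3 n) (T : Fin 8 → Fin 8 → Fin 8 → ℚ) :
    6 * (∑ i : Fin 8, ∑ j : Fin 8, ∑ k : Fin 8, n i j k * T i j k) =
      ∑ i : Fin 8, ∑ j : Fin 8, ∑ k : Fin 8,
        n i j k * (T i j k + T i k j + T j i k + T j k i + T k i j + T k j i) := by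
  have n3 : ∀ i j k, n k i j = n i j k := fun i j k => by rw [hn.swap12 k i j, hn.swap23 i k j]
  have n4 : ∀ i j k, n j k i = n i j k := fun i j k => by rw [hn.swap23 j k i, hn.swap12 j i k]
  have n5 : ∀ i j k, n k j i = n i j k := fun i j k => by rw [hn.swap12 k j i, n4]
  have h1 : (∑ i : Fin 8, ∑ j : Fin 8, ∑ k : Fin 8, n i j k * T i k j) =
      ∑ i : Fin 8, ∑ j : Fin 8, ∑ k : Fin 8, n i j k * T i j k := by
    rw [← sum3_reindex (fun i j k => n i j k * T i k j) σ23]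
    refine Finset.sum_congr rfl fun i _ => Finset.sum_congr rfl fun j _ => Finset.sum_congr rfl fun k _ => ?_
    show n i k j * T i j k = n i j k * T i j k
    rw [hn.swap23 i j k]
  have h2 : (∑ i : Fin 8, ∑ j : Fin 8, ∑ k : Fin 8, n i j k * T j i k) =
      ∑ i : Fin 8, ∑ j : Fin 8, ∑ k : Fin 8, n i j k * T i j k := by
    rw [← sum3_reindex (fun i j k => n i j k * T j i k) σ12]
    refine Finset.sum_congr rfl fun i _ => Finset.sum_congr rfl fun j _ => Finset.sum_congr rfl fun k _ => ?_
    show n j i k * T i j k = n i j k * T i j k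
    rw [hn.swap12 j i k]
  have h3 : (∑ i : Fin 8, ∑ j : Fin 8, ∑ k : Fin 8, n i j k * T j k i) =
      ∑ i : Fin 8, ∑ j : Fin 8, ∑ k : Fin 8, n i j k * T i j k := by
    rw [← sum3_reindex (fun i j k => n i j k * T j k i) σc']
    refine Finset.sum_congr rfl fun i _ => Finset.sum_congr rfl fun j _ => Finset.sum_congr rfl fun k _ => ?_
    show n k i j * T i j k = n i j k * T i j k
    rw [n3]
  have h4 : (∑ i : Fin 8, ∑ j : Fin 8, ∑ k : Fin 8, n i j k * T k i j) =
      ∑ i : Fin 8, ∑ j : Fin 8, ∑ k : Fin 8, n i j k * T i j k := by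
    rw [← sum3_reindex (fun i j k => n i j k * T k i j) σc]
    refine Finset.sum_congr rfl fun i _ => Finset.sum_congr rfl fun j _ => Finset.sum_congr rfl fun k _ => ?_
    show n j k i * T i j k = n i j k * T i j k
    rw [n4]
  have h5 : (∑ i : Fin 8, ∑ j : Fin 8, ∑ k : Fin 8, n i j k * T k j i) =
      ∑ i : Fin 8, ∑ j : Fin 8, ∑ k : Fin 8, n i j k * T i j k := by
    rw [← sum3_reindex (fun i j k => n i j k * T k j i) σ13]
    refine Finset.sum_congr rfl fun i _ => Finset.sum_congr rfl fun j _ => Finset.sum_congr rfl fun k _ => ?_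
    show n k j i * T i j k = n i j k * T i j k
    rw [n5]
  simp only [mul_add, Finset.sum_add_distrib]
  rw [h1, h2, h3, h4, h5]
  ring

end Sym

/-! ## The assembly -/

section Main

open Classical

variable {V : Type*} {E : Type*} [Fintype E] [DecidableEq E]

/-- The per-copy pinned count with no typed edge is the kernel at the pins. -/
lemma typedCount3_empty (z₁ z₂ z₃ : Config E) (τ : E → ℕ) (K : Config E → Config E → Config E → ℚ) :
    typedCount3 (∅ : Finset E) z₁ z₂ z₃ τ K = K z₁ z₂ z₃ := by
  unfold typedCount3
  have key : ∀ x y w : Config E,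
      ((∀ e, e ∉ (∅ : Finset E) → x e = z₁ e ∧ y e = z₂ e ∧ w e = z₃ e) ∧
        (∀ e ∈ (∅ : Finset E), openCount x y w e = τ e)) ↔ (x = z₁ ∧ y = z₂ ∧ w = z₃) := by
    intro x y w
    constructor
    · rintro ⟨h, -⟩
      exact ⟨funext fun e => (h e (Finset.notMem_empty e)).1,
        funext fun e => (h e (Finset.notMem_empty e)).2.1,
        funext fun e => (h e (Finset.notMem_empty e)).2.2⟩
    · rintro ⟨rfl, rfl, rfl⟩
      exact ⟨fun e _ => ⟨rfl, rfl, rfl⟩, fun e he => absurd he (Finset.notMem_empty e)⟩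
  simp only [key]
  rw [Finset.sum_eq_single_of_mem z₁ (Finset.mem_univ _)]
  · rw [Finset.sum_eq_single_of_mem z₂ (Finset.mem_univ _)]
    · rw [Finset.sum_eq_single_of_mem z₃ (Finset.mem_univ _)]
      · simp
      · intro w _ hw; simp [hw]
    · intro y _ hy; refine Finset.sum_eq_zero fun w _ => ?_; simp [hy]
  · intro x _ hx; refine Finset.sum_eq_zero fun y _ => Finset.sum_eq_zero fun w _ => ?_; simp [hx]

/-- **ROW 2′TRI WHENEVER THE TYPED EDGES ARE THE EDGES OF ONE UNMARKED THREE-TERMINAL PART**: for every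
finite graph, marking, part `W` with edge set `S`, pinning `z` and type map `τ`, `0 ≤ typedCount S z τ K₃`. -/
theorem typedCount_nonneg_pinned_part {ends : E → Sym2 V} {W : Set V} {t₁ t₂ t₃ : V}
    (hW : IsPart ends W t₁ t₂ t₃) {S : Finset E} (hS : ∀ e, e ∈ S ↔ e ∈ touches ends W)
    {e₁ e₂ e₃ : E} (h1 : e₁ ∈ S) (h2 : e₂ ∈ S) (h3 : e₃ ∈ S) (h12 : e₁ ≠ e₂) (h13 : e₁ ≠ e₃)
    (h23 : e₂ ≠ e₃) {o a₁ a₂ a₃ b : V} (ho : o ∉ W) (ha₁ : a₁ ∉ W) (ha₂ : a₂ ∉ W) (ha₃ : a₃ ∉ W)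
    (hb : b ∉ W) (z : Config E) (τ : E → ℕ) :
    0 ≤ typedCount S z τ (CovForm.K3 (R := ℚ) ends o a₁ a₂ a₃ b) := by
  have hd : Disjoint (∅ : Finset E) S := Finset.disjoint_empty_left S
  have e := typedCount_part_eq hW hS h1 h2 h3 h12 h13 h23 ho ha₁ ha₂ ha₃ hb hd z τ
  rw [Finset.empty_union] at e
  rw [e]
  set G' := partEnds ends (↑S) e₁ e₂ e₃ t₁ t₂ t₃ with hG'
  set n := partLaw S τ (pat ends S e₁ e₂ e₃ t₁ t₂ t₃) with hn
  have hsym : Sym3 n := partLaw_sym S τ _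
  have hnn : ∀ i j k, 0 ≤ n i j k := partLaw_nonneg S τ _
  -- the table through the states
  have hT : ∀ i j k : Fin 8, partTable ends S e₁ e₂ e₃ t₁ t₂ t₃ o a₁ a₂ a₃ b ∅ z τ i j k =
      ((KB (st G' o a₁ a₂ a₃ b (setOn S (cfg e₁ e₂ e₃ (rep8 i)) z))
        (st G' o a₁ a₂ a₃ b (setOn S (cfg e₁ e₂ e₃ (rep8 j)) z))
        (st G' o a₁ a₂ a₃ b (setOn S (cfg e₁ e₂ e₃ (rep8 k)) z)) : ℤ) : ℚ) := by
    intro i j k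
    rw [partTable_rep ends S h1 h2 h3 h12 h13 h23 t₁ t₂ t₃ o a₁ a₂ a₃ b hd z τ i j k]
    unfold partTable
    rw [typedCount3_empty]
    exact K3_eq_KB G' o a₁ a₂ a₃ b _ _ _
  simp only [hT]
  by_cases hQ : Conn G' (setOn S (cfg e₁ e₂ e₃ 0) z) a₁ a₂
  · -- every pattern configuration is off `Q`: every entry vanishes
    have hq : ∀ m : Fin 8, (st G' o a₁ a₂ a₃ b (setOn S (cfg e₁ e₂ e₃ m) z)).q' = true := by
      intro m
      show decide (Conn G' (setOn S (cfg e₁ e₂ e₃ m) z) a₂ a₁) = true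
      rw [decide_eq_true_iff]
      have hle : setOn S (cfg e₁ e₂ e₃ 0) z ≤ setOn S (cfg e₁ e₂ e₃ m) z := by
        rw [← background_setOn S e₁ e₂ e₃ z m]
        exact background_le S e₁ e₂ e₃ _
      exact conn_symm (conn_mono hle hQ)
    refine Finset.sum_nonneg fun i _ => Finset.sum_nonneg fun j _ => Finset.sum_nonneg fun k _ => ?_
    rw [KB_eq_zero_of_q' _ _ _ (Or.inl (hq (rep8 i)))]
    simp
  · -- the abstract states of the labeling
    have hst : ∀ m : Fin 8, st G' o a₁ a₂ a₃ b (setOn S (cfg e₁ e₂ e₃ m) z) =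
        stAbs (labOf G' (setOn S (cfg e₁ e₂ e₃ 0) z) a₁ a₂ (pt o b a₃ t₁ t₂ t₃)) m :=
      fun m => st_eq_stAbs ends S h1 h2 h3 h12 h13 h23 o a₁ a₂ a₃ b t₁ t₂ t₃ z hQ m
    simp only [hst]
    set f := labOf G' (setOn S (cfg e₁ e₂ e₃ 0) z) a₁ a₂ (pt o b a₃ t₁ t₂ t₃) with hf
    have hbd : ∀ v, (f v).val ≤ v.val + 2 := labOf_le G' _ a₁ a₂ _
    have hg : Guard f = true := guard_labOf G' _ a₁ a₂ _ hQ
    set T : Fin 8 → Fin 8 → Fin 8 → ℚ := fun i j k =>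
      ((KB (stAbs f (rep8 i)) (stAbs f (rep8 j)) (stAbs f (rep8 k)) : ℤ) : ℚ) with hTdef
    have hpos : ∀ i j k, 0 ≤ T i j k + T i k j + T j i k + T j k i + T k i j + T k j i := by
      intro i j k
      have := symKBS_nonneg_rep f hbd hg i j k
      unfold symKBS at this
      have hcast : T i j k + T i k j + T j i k + T j k i + T k i j + T k j i =
          ((KB (stAbs f (rep8 i)) (stAbs f (rep8 j)) (stAbs f (rep8 k)) +
            KB (stAbs f (rep8 i)) (stAbs f (rep8 k)) (stAbs f (rep8 j)) +
            KB (stAbs f (rep8 j)) (stAbs f (rep8 i)) (stAbs f (rep8 k)) +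
            KB (stAbs f (rep8 j)) (stAbs f (rep8 k)) (stAbs f (rep8 i)) +
            KB (stAbs f (rep8 k)) (stAbs f (rep8 i)) (stAbs f (rep8 j)) +
            KB (stAbs f (rep8 k)) (stAbs f (rep8 j)) (stAbs f (rep8 i)) : ℤ) : ℚ) := by
        simp only [hTdef]; push_cast; ring
      rw [hcast]
      exact_mod_cast this
    have key : 0 ≤ 6 * (∑ i : Fin 8, ∑ j : Fin 8, ∑ k : Fin 8, n i j k * T i j k) := by
      rw [sum_sym6 hsym T]
      exact Finset.sum_nonneg fun i _ => Finset.sum_nonneg fun j _ => Finset.sum_nonneg fun k _ =>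
        mul_nonneg (hnn i j k) (hpos i j k)
    have : (∑ i : Fin 8, ∑ j : Fin 8, ∑ k : Fin 8, n i j k * T i j k) =
        ∑ i : Fin 8, ∑ j : Fin 8, ∑ k : Fin 8, n i j k *
          ((KB (stAbs f (rep8 i)) (stAbs f (rep8 j)) (stAbs f (rep8 k)) : ℤ) : ℚ) := rfl
    rw [this] at key
    linarith

end Main

end Part

end Summit.Ventures.PercRepro2
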